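import Summits.QuantumAdvantage.QuantumAdvantage.Theorems.WalkTwoStepWalkAutomaton

/-!
# (G♯) local engine — toward `DensePinned p`: composing runs and the BLOCK BOOKKEEPING of contraction factors

Cell qa-qnc0, rung (G♯) = item stmt-QuantumAdvantage-23121 (planner qa-qnc0-p2 g24, ask P2-24b); prover qn-prover-3 g15.

The dense pinned branch bounds the bias by a product of BLOCK operator norms (ROUND-24 §1ter (d): good blocks contract by `1 − κ`, all
other blocks are nonexpansions).  This file is the generic bookkeeping on top of `WalkTwoStepTransferAutomaton.lean`:
* `runOps_add` — a run over `m₁ + m₂` steps is the run over the first `m₁` steps applied to the run over the last `m₂`;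
* `sumSq_runOps_blocks_le` — if consecutive blocks of lengths `len 0, len 1, …` have `ℓ²` contraction factors `fac i` (each `≤`-bound
  holding for every input weight), the whole run contracts by their product;
* `prod_fac_le_pow` — if at least `G` of the factors are `≤ ρ` and all are `≤ 1`, the product is `≤ ρ^G` — the shape
  `δ^{#good blocks}` of `DensePinned`.
WHAT THIS IS NOT: no block contraction lemma (N1) itself; separation NOT moved.
-/

namespace Summit.QuantumAdvantage.AdviceFreeQNC0.LocalEngine

open Finset Classical

section RunBlocks

variable {St : Type*}

/-- **Runs compose**: `run_{[t, t+m₁+m₂)} = run_{[t, t+m₁)} ∘ run_{[t+m₁, t+m₁+m₂)}`. -/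
theorem runOps_add (δ : ℕ → St → Bool → St) (s : ℕ → St → Bool → ℝ) :
    ∀ (m₁ t m₂ : ℕ) (φ : St → ℝ), runOps δ s t (m₁ + m₂) φ = runOps δ s t m₁ (runOps δ s (t + m₁) m₂ φ)
  | 0, t, m₂, φ => by simp [runOps]
  | m₁ + 1, t, m₂, φ => by
      rw [Nat.add_right_comm, runOps_succ, runOps_succ, runOps_add δ s m₁ (t + 1) m₂ φ, Nat.add_right_comm t 1 m₁, Nat.add_assoc]

variable [Fintype St]

/-- Start time of block `i`: `t₀ + len 0 + ⋯ + len (i−1)`. -/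
def blockStart (t₀ : ℕ) (len : ℕ → ℕ) (i : ℕ) : ℕ := t₀ + ∑ j ∈ Finset.range i, len j

/-- **Block bookkeeping**: per-block `ℓ²` contraction factors multiply. -/
theorem sumSq_runOps_blocks_le (δ : ℕ → St → Bool → St) (s : ℕ → St → Bool → ℝ) (t₀ : ℕ) (len : ℕ → ℕ) (fac : ℕ → ℝ)
    (hfac0 : ∀ i, 0 ≤ fac i)
    (hblock : ∀ i (f : St → ℝ), sumSq (runOps δ s (blockStart t₀ len i) (len i) f) ≤ fac i * sumSq f) :
    ∀ (k : ℕ) (φ : St → ℝ),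
      sumSq (runOps δ s t₀ (∑ j ∈ Finset.range k, len j) φ) ≤ (∏ j ∈ Finset.range k, fac j) * sumSq φ := by
  -- induction on the number of blocks, peeling the LAST block: run over k+1 blocks = (run over k blocks) ∘ (block k)
  intro k
  induction k with
  | zero => intro φ; simp [runOps]
  | succ k ih =>
      intro φ
      rw [Finset.sum_range_succ, runOps_add, Finset.prod_range_succ]
      have h1 := ih (runOps δ s (t₀ + ∑ j ∈ Finset.range k, len j) (len k) φ)
      have h2 := hblock k φ
      unfold blockStart at h2
      have hP : 0 ≤ ∏ j ∈ Finset.range k, fac j := Finset.prod_nonneg fun j _ => hfac0 j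
      calc sumSq (runOps δ s t₀ (∑ j ∈ Finset.range k, len j) (runOps δ s (t₀ + ∑ j ∈ Finset.range k, len j) (len k) φ))
          ≤ (∏ j ∈ Finset.range k, fac j) * sumSq (runOps δ s (t₀ + ∑ j ∈ Finset.range k, len j) (len k) φ) := h1
        _ ≤ (∏ j ∈ Finset.range k, fac j) * (fac k * sumSq φ) := mul_le_mul_of_nonneg_left h2 hP
        _ = (∏ j ∈ Finset.range k, fac j) * fac k * sumSq φ := by ring

/-- **Counting good blocks**: factors in `[0, 1]`, at least `G` of them `≤ ρ ≤ 1` ⇒ product `≤ ρ^G`. -/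
theorem prod_fac_le_pow (fac : ℕ → ℝ) (ρ : ℝ) (hρ : 0 ≤ ρ) (hρ1 : ρ ≤ 1) (k G : ℕ) (hfac0 : ∀ i, 0 ≤ fac i) (hfac1 : ∀ i, fac i ≤ 1)
    (hgood : G ≤ ((Finset.range k).filter fun i => fac i ≤ ρ).card) :
    ∏ j ∈ Finset.range k, fac j ≤ ρ ^ G := by
  set good := (Finset.range k).filter fun i => fac i ≤ ρ with hgood_def
  have hsplit := Finset.prod_filter_mul_prod_filter_not (Finset.range k) (fun i => fac i ≤ ρ) fac
  rw [← hsplit]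
  have h1 : ∏ j ∈ good, fac j ≤ ρ ^ good.card := by
    rw [← Finset.prod_const]
    exact Finset.prod_le_prod (fun i _ => hfac0 i) fun i hi => (Finset.mem_filter.mp hi).2
  have h2 : ∏ j ∈ (Finset.range k).filter (fun i => ¬ fac i ≤ ρ), fac j ≤ 1 := by
    calc ∏ j ∈ (Finset.range k).filter (fun i => ¬ fac i ≤ ρ), fac j
        ≤ ∏ j ∈ (Finset.range k).filter (fun i => ¬ fac i ≤ ρ), (1 : ℝ) :=
          Finset.prod_le_prod (fun i _ => hfac0 i) fun i _ => hfac1 i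
      _ = 1 := Finset.prod_const_one
  have h3 : ρ ^ good.card ≤ ρ ^ G := pow_le_pow_of_le_one hρ hρ1 hgood
  have hgnn : 0 ≤ ∏ j ∈ (Finset.range k).filter (fun i => ¬ fac i ≤ ρ), fac j := Finset.prod_nonneg fun i _ => hfac0 i
  calc (∏ j ∈ good, fac j) * ∏ j ∈ (Finset.range k).filter (fun i => ¬ fac i ≤ ρ), fac j
      ≤ ρ ^ good.card * 1 := mul_le_mul h1 h2 hgnn (pow_nonneg hρ _)
    _ = ρ ^ good.card := mul_one _
    _ ≤ ρ ^ G := h3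

end RunBlocks

end Summit.QuantumAdvantage.AdviceFreeQNC0.LocalEngine
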